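import Mathlib
import Summits.Ventures.PercRepro2.LocRows
import Summits.Ventures.PercRepro2.SwRow

/-!
# Clusters of an edge-list graph by bitmask closure passes
(blind cell PercRepro2, night-4 g15, 2026-08-26; proofs/NIGHT4-G15.md §3)

A finite graph is given as an edge list `es : List (Fin n × Fin n)` (`endsOf es : Fin es.length →
Sym2 (Fin n)`), a configuration as a bitmask `ω : ℕ` (bit `i` = edge `i` red, `toConfig`), a vertex
set as a bitmask over `Fin n`.  `clusterMask ω es v` computes the red cluster of `v` by `n` closure
passes along the edge list (`headStep` / `stepAux` / `iter`), and **`clusterMask_testBit_iff`** says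
it IS the cluster `cluster (endsOf es) (toConfig ω) v`: soundness by the closure lemma
`mem_of_conn_of_closed` (the mask stays inside the cluster), completeness along a path of the open
graph of length `< n` (`testBit_iter_of_walk`, `Walk.IsPath.length_lt`).  Everything is computable
by the kernel (`Nat.testBit`, `|||`, `2 ^ ·`): the next file `SwCheck` builds the (SW) certificate
checker on it.
-/

namespace Summit.Ventures.PercRepro2

namespace SwCheck

open Hull LocRows

variable {n : ℕ}

/-- The edge-list graph: the `i`-th edge joins the two components of `es[i]`. -/
def endsOf (es : List (Fin n × Fin n)) : Fin es.length → Sym2 (Fin n) :=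
  fun i => s((es.get i).1, (es.get i).2)

/-- The configuration encoded by the bitmask `ω`: edge `e` is red iff bit `e` of `ω` is set. -/
def toConfig (m : ℕ) (ω : ℕ) : Config (Fin m) := fun e => ω.testBit e.val

/-- Add the endpoint `b` of the edge `(a, b)` of index `i` when the edge is red and `a ∈ S`. -/
def addEnd (ω i : ℕ) (a b : Fin n) (S : ℕ) : ℕ :=
  if ω.testBit i && S.testBit a.val then S ||| 2 ^ b.val else S

/-- The mask after one edge `(a, b)` of index `i`: if the edge is red, each endpoint whose other
endpoint lies in `S` is added. -/
def headStep (ω i : ℕ) (a b : Fin n) (S : ℕ) : ℕ := addEnd ω i b a (addEnd ω i a b S)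

/-- One closure pass along the edge list from the index `i`. -/
def stepAux (ω : ℕ) : List (Fin n × Fin n) → ℕ → ℕ → ℕ
  | [], _, S => S
  | (a, b) :: es, i, S => stepAux ω es (i + 1) (headStep ω i a b S)

/-- `k` closure passes. -/
def iter (ω : ℕ) (es : List (Fin n × Fin n)) : ℕ → ℕ → ℕ
  | 0, S => S
  | k + 1, S => iter ω es k (stepAux ω es 0 S)

/-- The red cluster of `v` as a vertex mask: `n` closure passes from `{v}`. -/
def clusterMask (ω : ℕ) (es : List (Fin n × Fin n)) (v : Fin n) : ℕ := iter ω es n (2 ^ v.val)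

/-! ## The bits of one edge step -/

/-- The bits of `addEnd`. -/
lemma testBit_addEnd_iff (ω i : ℕ) (a b : Fin n) (S x : ℕ) :
    (addEnd ω i a b S).testBit x = true ↔
      S.testBit x = true ∨ (ω.testBit i = true ∧ S.testBit a.val = true ∧ b.val = x) := by
  unfold addEnd
  split_ifs with h
  · simp only [Bool.and_eq_true] at h
    simp only [Nat.testBit_lor, Nat.testBit_two_pow, Bool.or_eq_true, decide_eq_true_eq]
    constructor
    · rintro (hx | hx)
      · exact Or.inl hx
      · exact Or.inr ⟨h.1, h.2, hx⟩
    · rintro (hx | ⟨_, _, hx⟩)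
      · exact Or.inl hx
      · exact Or.inr hx
  · simp only [Bool.and_eq_true] at h
    constructor
    · intro hx; exact Or.inl hx
    · rintro (hx | ⟨hr, ha, _⟩)
      · exact hx
      · exact absurd ⟨hr, ha⟩ h

/-- The bits of `headStep`: the old bits, and each endpoint of a red edge whose other endpoint is
in `S`. -/
lemma testBit_headStep_iff (ω i : ℕ) (a b : Fin n) (S x : ℕ) :
    (headStep ω i a b S).testBit x = true ↔
      S.testBit x = true ∨ (ω.testBit i = true ∧ S.testBit a.val = true ∧ b.val = x) ∨
        (ω.testBit i = true ∧ S.testBit b.val = true ∧ a.val = x) := by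
  unfold headStep
  rw [testBit_addEnd_iff, testBit_addEnd_iff, testBit_addEnd_iff]
  constructor
  · rintro ((hx | ⟨hr, ha, hb⟩) | ⟨hr, (hb | ⟨_, ha, _⟩), hax⟩)
    · exact Or.inl hx
    · exact Or.inr (Or.inl ⟨hr, ha, hb⟩)
    · exact Or.inr (Or.inr ⟨hr, hb, hax⟩)
    · exact Or.inl (hax ▸ ha)
  · rintro (hx | ⟨hr, ha, hb⟩ | ⟨hr, hb, hax⟩)
    · exact Or.inl (Or.inl hx)
    · exact Or.inl (Or.inr ⟨hr, ha, hb⟩)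
    · exact Or.inr ⟨hr, Or.inl hb, hax⟩

/-! ## Monotonicity of the passes -/

/-- An edge step only adds vertices. -/
lemma testBit_headStep_of_testBit (ω i : ℕ) (a b : Fin n) (S x : ℕ) (hx : S.testBit x = true) :
    (headStep ω i a b S).testBit x = true :=
  (testBit_headStep_iff ω i a b S x).2 (Or.inl hx)

/-- A pass only adds vertices. -/
lemma testBit_stepAux_of_testBit (ω : ℕ) (es : List (Fin n × Fin n)) (i S x : ℕ)
    (hx : S.testBit x = true) : (stepAux ω es i S).testBit x = true := by
  induction es generalizing i S with
  | nil => simpa [stepAux] using hx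
  | cons ab es ih =>
    obtain ⟨a, b⟩ := ab
    exact ih _ _ (testBit_headStep_of_testBit ω i a b S x hx)

/-- An edge step is monotone in the vertex mask. -/
lemma headStep_mono (ω i : ℕ) (a b : Fin n) (S S' : ℕ)
    (hSS' : ∀ x, S.testBit x = true → S'.testBit x = true) :
    ∀ x, (headStep ω i a b S).testBit x = true → (headStep ω i a b S').testBit x = true := by
  intro x hx
  rw [testBit_headStep_iff] at hx ⊢
  rcases hx with hx | ⟨hr, ha, hb⟩ | ⟨hr, hb, ha⟩
  · exact Or.inl (hSS' x hx)
  · exact Or.inr (Or.inl ⟨hr, hSS' _ ha, hb⟩)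
  · exact Or.inr (Or.inr ⟨hr, hSS' _ hb, ha⟩)

/-- A pass is monotone in the vertex mask. -/
lemma stepAux_mono (ω : ℕ) (es : List (Fin n × Fin n)) (i S S' : ℕ)
    (hSS' : ∀ x, S.testBit x = true → S'.testBit x = true) :
    ∀ x, (stepAux ω es i S).testBit x = true → (stepAux ω es i S').testBit x = true := by
  induction es generalizing i S S' with
  | nil => intro x hx; simpa [stepAux] using hSS' x (by simpa [stepAux] using hx)
  | cons ab es ih =>
    obtain ⟨a, b⟩ := ab
    intro x hx
    exact ih _ _ _ (headStep_mono ω i a b S S' hSS') x hx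

/-- Iterating passes only adds vertices. -/
lemma testBit_iter_of_testBit (ω : ℕ) (es : List (Fin n × Fin n)) (k S x : ℕ)
    (hx : S.testBit x = true) : (iter ω es k S).testBit x = true := by
  induction k generalizing S with
  | zero => simpa [iter] using hx
  | succ k ih => exact ih _ (testBit_stepAux_of_testBit ω es 0 S x hx)

/-- Iteration is monotone in the vertex mask. -/
lemma iter_mono (ω : ℕ) (es : List (Fin n × Fin n)) (k S S' : ℕ)
    (hSS' : ∀ x, S.testBit x = true → S'.testBit x = true) :
    ∀ x, (iter ω es k S).testBit x = true → (iter ω es k S').testBit x = true := by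
  induction k generalizing S S' with
  | zero => intro x hx; simpa [iter] using hSS' x (by simpa [iter] using hx)
  | succ k ih =>
    intro x hx
    exact ih _ _ (stepAux_mono ω es 0 S S' hSS') x hx

/-- More passes only add vertices. -/
lemma iter_le (ω : ℕ) (es : List (Fin n × Fin n)) (k k' S : ℕ) (hk : k ≤ k') :
    ∀ x, (iter ω es k S).testBit x = true → (iter ω es k' S).testBit x = true := by
  induction k' generalizing k with
  | zero =>
    intro x hx
    have : k = 0 := by omega
    subst this; exact hx
  | succ k' ih =>
    intro x hx
    rcases Nat.eq_or_lt_of_le hk with rfl | hlt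
    · exact hx
    · have h1 := ih k (by omega) x hx
      exact iter_mono ω es k' S _ (fun y hy => testBit_stepAux_of_testBit ω es 0 S y hy) x h1

/-! ## Soundness: every vertex of a pass lies in a closed set containing the start -/

/-- If `C` is closed under the red edges of the list (indices offset by `i`) and contains `S`,
it contains the pass. -/
lemma stepAux_subset (ω : ℕ) (es : List (Fin n × Fin n)) (i S : ℕ) (C : Set (Fin n))
    (hC : ∀ j (hj : j < es.length), ω.testBit (i + j) = true →
      ((es.get ⟨j, hj⟩).1 ∈ C ↔ (es.get ⟨j, hj⟩).2 ∈ C))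
    (hS : ∀ x : Fin n, S.testBit x.val = true → x ∈ C) :
    ∀ x : Fin n, (stepAux ω es i S).testBit x.val = true → x ∈ C := by
  induction es generalizing i S with
  | nil => intro x hx; exact hS x (by simpa [stepAux] using hx)
  | cons ab es ih =>
    obtain ⟨a, b⟩ := ab
    intro x hx
    have h0 : ω.testBit i = true → (a ∈ C ↔ b ∈ C) := fun hr =>
      hC 0 (by simp) (by rw [Nat.add_zero]; exact hr)
    refine ih (i + 1) _ ?_ ?_ x hx
    · intro j hj hred
      have := hC (j + 1) (by simpa using Nat.succ_lt_succ hj)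
        (by rw [show i + (j + 1) = i + 1 + j by omega]; exact hred)
      simpa using this
    · intro y hy
      rw [testBit_headStep_iff] at hy
      rcases hy with hy | ⟨hr, ha, hb⟩ | ⟨hr, hb, ha⟩
      · exact hS y hy
      · have : b = y := Fin.ext hb
        subst this
        exact (h0 hr).1 (hS a ha)
      · have : a = y := Fin.ext ha
        subst this
        exact (h0 hr).2 (hS b hb)

/-- The same for `k` passes (indices from `0`). -/
lemma iter_subset (ω : ℕ) (es : List (Fin n × Fin n)) (k S : ℕ) (C : Set (Fin n))
    (hC : ∀ j (hj : j < es.length), ω.testBit j = true →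
      ((es.get ⟨j, hj⟩).1 ∈ C ↔ (es.get ⟨j, hj⟩).2 ∈ C))
    (hS : ∀ x : Fin n, S.testBit x.val = true → x ∈ C) :
    ∀ x : Fin n, (iter ω es k S).testBit x = true → x ∈ C := by
  induction k generalizing S with
  | zero => intro x hx; exact hS x (by simpa [iter] using hx)
  | succ k ih =>
    intro x hx
    refine ih _ ?_ x hx
    exact stepAux_subset ω es 0 S C (by simpa using hC) hS

/-! ## Completeness: a red edge from the mask enters the pass -/

/-- A red edge (index `i + j` in the list from index `i`) with one endpoint in `S` puts the other
endpoint into the pass. -/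
lemma testBit_stepAux_of_edge (ω : ℕ) (es : List (Fin n × Fin n)) (i S : ℕ) (j : ℕ)
    (hj : j < es.length) (hred : ω.testBit (i + j) = true) :
    (S.testBit (es.get ⟨j, hj⟩).1.val = true →
        (stepAux ω es i S).testBit (es.get ⟨j, hj⟩).2.val = true) ∧
    (S.testBit (es.get ⟨j, hj⟩).2.val = true →
        (stepAux ω es i S).testBit (es.get ⟨j, hj⟩).1.val = true) := by
  induction es generalizing i S j with
  | nil => simp at hj
  | cons ab es ih =>
    obtain ⟨a, b⟩ := ab
    cases j with
    | zero =>
      rw [Nat.add_zero] at hred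
      show (S.testBit a.val = true → (stepAux ω es (i + 1) (headStep ω i a b S)).testBit b.val = true) ∧
        (S.testBit b.val = true → (stepAux ω es (i + 1) (headStep ω i a b S)).testBit a.val = true)
      constructor
      · intro ha
        apply testBit_stepAux_of_testBit
        exact (testBit_headStep_iff ω i a b S b.val).2 (Or.inr (Or.inl ⟨hred, ha, rfl⟩))
      · intro hb
        apply testBit_stepAux_of_testBit
        exact (testBit_headStep_iff ω i a b S a.val).2 (Or.inr (Or.inr ⟨hred, hb, rfl⟩))
    | succ j =>
      have hred' : ω.testBit (i + 1 + j) = true := by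
        rw [Nat.add_right_comm]; exact hred
      have key := ih (i + 1) (headStep ω i a b S) j (by simpa using Nat.lt_of_succ_lt_succ hj) hred'
      exact ⟨fun h => key.1 (testBit_headStep_of_testBit ω i a b S _ h),
        fun h => key.2 (testBit_headStep_of_testBit ω i a b S _ h)⟩

/-! ## The mask is the cluster -/

/-- Red edges of the configuration `toConfig ω` are the set bits of `ω`. -/
lemma toConfig_apply (m ω : ℕ) (e : Fin m) : toConfig m ω e = ω.testBit e.val := rfl

/-- A walk of the open graph from `v` to `x` of length `k` puts `x` into `k` passes from `{v}`. -/
lemma testBit_iter_of_walk (ω : ℕ) (es : List (Fin n × Fin n)) (v : Fin n) :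
    ∀ {x : Fin n} (p : (openGraph (endsOf es) (toConfig es.length ω)).Walk v x),
      (iter ω es p.length (2 ^ v.val)).testBit x.val = true := by
  intro x p
  induction p with
  | nil => simp [iter]
  | @cons u w x huw p ih =>
    simp only [SimpleGraph.Walk.length_cons]
    -- `{w} ⊆ step {u}`: the edge `u w` is red
    obtain ⟨_, e, he, hends⟩ := openGraph_adj.1 huw
    have hw : (stepAux ω es 0 (2 ^ u.val)).testBit w.val = true := by
      have h1 : s((es.get e).1, (es.get e).2) = s(u, w) := hends
      rw [Sym2.eq_iff] at h1
      have hred : ω.testBit (0 + e.val) = true := by simpa [toConfig] using he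
      have key := testBit_stepAux_of_edge ω es 0 (2 ^ u.val) e.val e.isLt hred
      rcases h1 with ⟨h1, h2⟩ | ⟨h1, h2⟩
      · rw [← h2]; exact key.1 (by rw [h1]; simp)
      · rw [← h1]; exact key.2 (by rw [h2]; simp)
    show (iter ω es p.length (stepAux ω es 0 (2 ^ u.val))).testBit x.val = true
    refine iter_mono ω es p.length (2 ^ w.val) _ ?_ x.val ih
    intro y hy
    rw [Nat.testBit_two_pow] at hy
    simp only [decide_eq_true_eq] at hy
    rw [← hy]; exact hw

/-- **The mask is the cluster**: bit `x` of `clusterMask ω es v` is set iff `x` lies in the red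
cluster of `v` in the configuration `toConfig ω`. -/
theorem clusterMask_testBit_iff (ω : ℕ) (es : List (Fin n × Fin n)) (v x : Fin n) :
    (clusterMask ω es v).testBit x.val = true ↔ x ∈ cluster (endsOf es) (toConfig es.length ω) v := by
  constructor
  · intro hx
    refine iter_subset ω es n (2 ^ v.val) (cluster (endsOf es) (toConfig es.length ω) v) ?_ ?_ x hx
    · intro j hj hred
      have hends : endsOf es ⟨j, hj⟩ = s((es.get ⟨j, hj⟩).1, (es.get ⟨j, hj⟩).2) := rfl
      have he : toConfig es.length ω ⟨j, hj⟩ = true := hred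
      exact ⟨fun h => mem_cluster_of_edge h he hends,
        fun h => mem_cluster_of_edge h he (ends_swap hends)⟩
    · intro y hy
      rw [Nat.testBit_two_pow] at hy
      simp only [decide_eq_true_eq] at hy
      have : v = y := Fin.ext hy
      subst this
      exact mem_cluster_self _ _ _
  · intro hx
    obtain ⟨p⟩ := (mem_cluster.1 hx)
    obtain ⟨q, hq⟩ : ∃ q : (openGraph (endsOf es) (toConfig es.length ω)).Walk v x, q.IsPath :=
      ⟨p.bypass, p.bypass_isPath⟩
    have hlen : q.length < n := by simpa using hq.length_lt
    exact iter_le ω es q.length n (2 ^ v.val) hlen.le x.val (testBit_iter_of_walk ω es v q)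

end SwCheck

end Summit.Ventures.PercRepro2
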